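import Summits.CriticalPhenomena.CardyFormulaZ2.Theorems.CardyIKTransportIKMixedBoxCrossingTransportStubCylExchange
import Summits.CriticalPhenomena.CardyFormulaZ2.Theorems.CardyIKTransportIKMixedBoxCrossingTransportStubSlabDeterminacy
import Summits.CriticalPhenomena.CardyFormulaZ2.Theorems.CardyIKTransportIKMixedBoxCrossingTransportStubCylBunch
import Summits.CriticalPhenomena.CardyFormulaZ2.Theorems.CardyIKTransportIKMixedBoxCrossingTransportStubCylPlane
import Summits.CriticalPhenomena.CardyFormulaZ2.Theorems.CardyIKTransportIKMixedBoxCrossingTransportStubTriCylArcs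
import Summits.CriticalPhenomena.CardyFormulaZ2.Theorems.CardyIKTransportIKMixedBoxCrossingTransportStubLastFaceMono
import Summits.CriticalPhenomena.CardyFormulaZ2.Theorems.CardyIKTransportIKMixedBoxCrossingTransportStubArcsIsoGeHon
import Summits.CriticalPhenomena.CardyFormulaZ2.Theorems.CardyIKTransportIKMixedBoxCrossingTransportStubLinkTelescope
import Summits.CriticalPhenomena.CardyFormulaZ2.Theorems.CardyIKTransportIKMixedBoxCrossingTransportStubLinkHonCount
import Summits.CriticalPhenomena.CardyFormulaZ2.Theorems.CardyIKTransportIKMixedBoxCrossingTransportStubLinkTraceIneq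
import Summits.CriticalPhenomena.CardyFormulaZ2.Theorems.CardyIKTransportIKMixedBoxCrossingTransportStubNecklaceConst
import Summits.CriticalPhenomena.CardyFormulaZ2.Theorems.CardyIKTransportIKMixedBoxCrossingTransportStubLinkArcsIff
import Summits.CriticalPhenomena.CardyFormulaZ2.Theorems.CardyIKTransportIKMixedBoxCrossingTransportStubLinkIsoTrace
import Summits.CriticalPhenomena.CardyFormulaZ2.Theorems.CardyIKTransportIKMixedBoxCrossingStubPatternLocality
import Summits.CriticalPhenomena.CardyFormulaZ2.Theorems.CardyIKTransportIKMixedBoxCrossingStubQuarterTurn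
import Summits.CriticalPhenomena.CardyFormulaZ2.Theorems.CardyIKTransportIKMixedBoxCrossingDefectStubBridge
import Summits.CriticalPhenomena.CardyFormulaZ2.Theorems.CardyIKTransportIKMixedBoxCrossingDefectStubFreeLocality

/-!
# THE VERTICAL CLAUSE OF `IKMixedBoxCrossing` FOR EVERY PATTERN, and RSW for the isotropic Izergin–Korepin model
# (`PureIKBoxCrossing`) — sorry-free assembly (line `defect-closure-exploration`, reshape v5b, crux stmt-CriticalPhenomena-5911)

Support file (`--supports stmt-CriticalPhenomena-5911`).  Everything below is glue over LANDED files: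
* the Yang–Baxter transport of lead c4 (`stub_cylExchange`, `stub_slabDeterminacy`, `stub_cylBunch`, `stub_cylPlane`,
  `stub_triCylArcs`);
* the monotonicity of lead c5: `UnivCylArcs` from the 1D link lemma `LastColLinkMono` (`stub_lastFaceMono_of`, `stub_arcsIsoGeHon_of`,
  `univCylArcs_of_mono`) and the link decomposition of `LastColLinkMono` (`stub_necklaceConst`, `stub_linkArcsIff`,
  `stub_linkHonCount`, `stub_linkIsoTraceNorm`, `stub_linkTraceIneq`, `stub_linkTelescope`, `lastColLinkMono_of`) — paper proof in
  the crux memo `Cruxes/IKMixedBoxCrossing/Lines/defect-closure-exploration-c5.md` §9 (gap-crossing domination, sharp constant 432/427);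
* the landed structure of the earlier reshapes (`stub_bridge`, `stub_patternLocality`, `stub_quarterTurn`, `stub_freeLocality`).
RESULTS: `stub_lastColLinkMono : LastColLinkMono`, `stub_univCylArcs : UnivCylArcs` (registered stub of v4, now PROVED),
`verticalClause` (for every column pattern `S`, the `n × 2n` cell boxes are crossed bottom-to-top by a black path with probability
bounded below uniformly), and `stub_pureIK` (registered stub of v3: `PureIKBoxCrossing`, RSW for the isotropic model, both clauses).
-/

noncomputable section

namespace Summit.CriticalPhenomena.CardyFormulaZ2.Cruxes.IKMixedBoxCrossing.DefectClosureExploration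

open Summit.CriticalPhenomena.CardyFormulaZ2.Cruxes.IKMixedBoxCrossing.PairedMirrorExploration
  (pTB stub_patternLocality stub_quarterTurn)

/-- **The 1D link lemma** (`LastColLinkMono`) from its landed decomposition. -/
theorem stub_lastColLinkMono : LastColLinkMono :=
  lastColLinkMono_of stub_necklaceConst.1 stub_necklaceConst.2 stub_linkArcsIff stub_linkHonCount
    stub_linkIsoTraceNorm.1 stub_linkTelescope stub_linkTraceIneq stub_linkIsoTraceNorm.2

/-- **`UnivCylArcs` PROVED**: RSW for the isotropic Izergin–Korepin cell model in cylinder-arcs form (the open residue of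
reshape v4) — isotropic ≥ honeycomb by monotonicity in the face type, honeycomb by the tree's RSW for site percolation on `𝕋`. -/
theorem stub_univCylArcs : UnivCylArcs :=
  univCylArcs_of_mono (stub_arcsIsoGeHon_of stub_cylExchange stub_slabDeterminacy
    (stub_lastFaceMono_of stub_lastColLinkMono)) stub_triCylArcs

/-- **THE VERTICAL CLAUSE OF THE CRUX FOR EVERY COLUMN PATTERN**: there is `c > 0` such that for every `S ⊆ ℤ`, `n ≥ 1` and
position, the `n × 2n` cell box is crossed bottom-to-top by a black path with probability at least `c`. -/
theorem verticalClause : ∃ c : ℝ, 0 < c ∧ ∀ (S : Set ℤ) (n : ℕ) (a b : ℤ), 1 ≤ n → c ≤ pTB S a b n (2 * n) :=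
  verticalFloor_of (stub_cylBunch stub_cylExchange stub_slabDeterminacy) stub_cylPlane stub_triCylArcs stub_univCylArcs

/-- **RSW FOR THE ISOTROPIC IZERGIN–KOREPIN MODEL** (`PureIKBoxCrossing`, registered stub `stub_pureIK` of reshape v3, now
unconditional in its three legacy hypotheses): both the `2n × n` and the `n × 2n` boxes whose columns are all isotropic are crossed
the long way with probability bounded below. -/
theorem stub_pureIK : ClosureMarkov → PolymerTail → SubcriticalMaskDensity → PureIKBoxCrossing :=
  fun _ _ _ => pureIK_of_transport stub_bridge stub_patternLocality stub_quarterTurn stub_freeLocality verticalClause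

end Summit.CriticalPhenomena.CardyFormulaZ2.Cruxes.IKMixedBoxCrossing.DefectClosureExploration

end
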